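import Mathlib
import Literature.Computability.AlgebraicComplexity.StandardFamilies
import Literature.Computability.AlgebraicComplexity.PolarizationIdentity

/-!
# `ChowBorderBound` is FALSE without its bound on the padding degree `D`
# (Kumar's border fan-in-two construction for `per_n`; crux stmt-ValiantsHypothesis-5936)

Support file (`--supports stmt-ValiantsHypothesis-5936`) of route `ValiantsHypothesis/ChowBorderDepth3`,
negative side.  The crux `ChowBorderBound` bounds BOTH the number `r` of products and the number
`D` of affine factors by `(n+2)^(c⌊√n⌋+c)`.  This file proves that the bound on `D` cannot be
dropped: for every `n ≥ 1` the padded permanent HAS a border `σ_2(Ch_D)`-expression, i.e. one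
with only `r = 2` products (`exists_border_fanInTwo`), so that the crux with the hypothesis
`D ≤ (n+2)^(c⌊√n⌋+c)` deleted is false (`chowBorderBound_false_without_DBound`).

This is M. Kumar's theorem (*On the power of border of depth-3 arithmetic circuits*, ACM ToCT 12
(2020), doi:10.1145/3371506, Thm. 1.1: every homogeneous degree-`d` form is in the border of
`Σ^[2]ΠΣ` circuits of product fan-in `d · WaringRank`) specialised to the permanent, with the
Waring decomposition supplied by the polarisation identity
(`Literature.….sum_neg_one_pow_mul_sum_pow`): `per_n = Σ_σ Π_l x_{σ l, l}` and
`n! · Π_l y_l = Σ_{S ⊆ [n]} (-1)^(n-|S|) (Σ_{l∈S} y_l)^n`, so `per_n = Σ_s c_s L_s^n` over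
`s = (σ, S)`; with `λ_s^n = -c_s` and `ζ` a primitive `n`-th root of unity,
`Π_{k<n} (1 - ζ^k λ_s ε L_s) = 1 - (λ_s ε L_s)^n = 1 + ε^n c_s L_s^n` (`prod_one_sub_smul`), hence
`Π_s Π_k (1 - ζ^k λ_s ε L_s) = 1 + ε^n per_n + ε^(2n) H` and
`(-1)·1⋯1 + Π_{s,k} (…) = ε^n per_n + ε^(n+1) (ε^(n-1) H)`: two products of `D = n · n! · 2^n`
affine forms.  (So any proof of the crux must use `D ≤ (n+2)^(c⌊√n⌋+c)`; together with the
rung `r ≤ 2` of the crux — `2D ≥ C(n,⌊n/2⌋)²` is forced for two LOCAL summands — this brackets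
the fan-in-two case.)

References: M. Kumar, ACM ToCT 12 (2020), doi:10.1145/3371506, Thm 1.1; J. M. Landsberg,
*Geometry and complexity theory*, CUP 2017, §7.4 (polarisation), Cor. 7.5.3.3 (the crux).
-/

noncomputable section

-- `Summit.ValiantsHypothesis.ValiantsHypothesis.…` is the tree's mandated single-conjunct layout
-- (Sub = Summit), so the duplicated namespace component is intended.
set_option linter.dupNamespace false

namespace Summit.ValiantsHypothesis.ValiantsHypothesis.Theorems.ChowBorderBound.NegativeDBound

open MvPolynomial Literature.Computability.AlgebraicComplexity
open scoped Polynomial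

/-! ## §1 Roots of unity: `Π_{k<n} (1 - ζ^k u) = 1 - u^n` -/

section RootsOfUnity

variable {n : ℕ} {ζ : ℂ}

/-- `X^n - 1 = Π_{k<n} (X - ζ^k)` for a primitive `n`-th root of unity `ζ`. [folklore] -/
theorem X_pow_sub_one_eq_prod_range (hn : 0 < n) (hζ : IsPrimitiveRoot ζ n) :
    (Polynomial.X ^ n - 1 : ℂ[X]) =
      ∏ k ∈ Finset.range n, (Polynomial.X - Polynomial.C (ζ ^ k)) := by
  classical
  haveI : NeZero n := ⟨hn.ne'⟩
  rw [Polynomial.X_pow_sub_one_eq_prod hn hζ]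
  have hset : Polynomial.nthRootsFinset n (1 : ℂ) = (Finset.range n).image fun k => ζ ^ k := by
    ext x
    rw [Polynomial.mem_nthRootsFinset hn, Finset.mem_image]
    constructor
    · intro hx
      obtain ⟨i, hi, rfl⟩ := hζ.eq_pow_of_pow_eq_one hx
      exact ⟨i, Finset.mem_range.2 hi, rfl⟩
    · rintro ⟨i, -, rfl⟩
      rw [← pow_mul, mul_comm, pow_mul, hζ.pow_eq_one, one_pow]
  rw [hset, Finset.prod_image]
  intro i hi j hj h
  exact hζ.pow_inj (Finset.mem_range.1 hi) (Finset.mem_range.1 hj) h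

/-- `Π_{k<n} (1 - ζ^k w) = 1 - w^n` for complex `w`. [folklore] -/
theorem prod_one_sub_pow_mul (hn : 0 < n) (hζ : IsPrimitiveRoot ζ n) (w : ℂ) :
    ∏ k ∈ Finset.range n, (1 - ζ ^ k * w) = 1 - w ^ n := by
  by_cases hw : w = 0
  · simp [hw, zero_pow hn.ne']
  · have h := congrArg (Polynomial.eval w⁻¹) (X_pow_sub_one_eq_prod_range hn hζ)
    simp only [Polynomial.eval_sub, Polynomial.eval_pow, Polynomial.eval_X, Polynomial.eval_one,
      Polynomial.eval_prod, Polynomial.eval_C] at h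
    have hwn : w ^ n ≠ 0 := pow_ne_zero _ hw
    have key : w ^ n * ∏ k ∈ Finset.range n, (w⁻¹ - ζ ^ k) =
        ∏ k ∈ Finset.range n, (1 - ζ ^ k * w) := by
      rw [← Finset.card_range n, ← Finset.prod_const, Finset.card_range, ← Finset.prod_mul_distrib]
      refine Finset.prod_congr rfl fun k _ => ?_
      rw [mul_sub, mul_inv_cancel₀ hw]
      ring
    rw [← key, ← h, inv_pow, mul_sub, mul_inv_cancel₀ hwn, mul_one]

/-- `Π_{k<n} (1 - ζ^k X) = 1 - X^n` in `ℂ[X]`. [folklore] -/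
theorem prod_one_sub_C_mul_X (hn : 0 < n) (hζ : IsPrimitiveRoot ζ n) :
    ∏ k ∈ Finset.range n, (1 - Polynomial.C (ζ ^ k) * Polynomial.X : ℂ[X]) =
      1 - Polynomial.X ^ n := by
  apply Polynomial.funext
  intro w
  simp only [Polynomial.eval_prod, Polynomial.eval_sub, Polynomial.eval_one, Polynomial.eval_mul,
    Polynomial.eval_C, Polynomial.eval_X, Polynomial.eval_pow]
  exact prod_one_sub_pow_mul hn hζ w

/-- `Π_{k<n} (1 - ζ^k u) = 1 - u^n` in any commutative `ℂ`-algebra. [folklore] -/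
theorem prod_one_sub_smul {B : Type*} [CommRing B] [Algebra ℂ B] (hn : 0 < n)
    (hζ : IsPrimitiveRoot ζ n) (u : B) :
    ∏ k ∈ Finset.range n, (1 - algebraMap ℂ B ζ ^ k * u) = 1 - u ^ n := by
  have h := congrArg (Polynomial.aeval u) (prod_one_sub_C_mul_X hn hζ)
  simp only [map_prod, map_sub, map_one, map_mul, Polynomial.aeval_C, Polynomial.aeval_X,
    map_pow] at h
  exact h

end RootsOfUnity

/-! ## §2 First-order expansion of a product of perturbations of `1` -/

section Expansion

variable {A : Type*} [CommRing A]

/-- `Π_{i∈s} (1 + t f_i) = 1 + t Σ_{i∈s} f_i + t² H` for some `H`. [folklore] -/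
theorem exists_prod_one_add_mul {ι : Type*} (s : Finset ι) (t : A) (f : ι → A) :
    ∃ H : A, ∏ i ∈ s, (1 + t * f i) = 1 + t * ∑ i ∈ s, f i + t ^ 2 * H := by
  classical
  induction s using Finset.induction_on with
  | empty => exact ⟨0, by simp⟩
  | insert a s ha ih =>
    obtain ⟨H, hH⟩ := ih
    refine ⟨H + f a * ∑ i ∈ s, f i + t * f a * H, ?_⟩
    rw [Finset.prod_insert ha, hH, Finset.sum_insert ha]
    ring

end Expansion

/-! ## §3 The permanent as a sum of `n`-th powers of linear forms (polarisation) -/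

section Waring

variable (n : ℕ)

/-- **Waring decomposition of the permanent** (polarisation of each permutation monomial):
`per_n = Σ_{(σ,S)} c_{σ,S} · L_{σ,S}^n` with `L_{σ,S} = Σ_{l∈S} x_{σ l, l}` and
`c_{σ,S} = (-1)^(n-|S|)/n!`. [cite: LandsbergGCT2017, §7.4] -/
theorem perPoly_eq_sum_smul_pow :
    perPoly (Fin n) ℂ = ∑ s : Equiv.Perm (Fin n) × Finset (Fin n),
      ((-1) ^ (n - s.2.card) / n.factorial : ℂ) •
        (∑ l ∈ s.2, (X (s.1 l, l) : MvPolynomial (Fin n × Fin n) ℂ)) ^ n := by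
  classical
  have hper : perPoly (Fin n) ℂ = ∑ σ : Equiv.Perm (Fin n), ∏ i, (X (σ i, i) :
      MvPolynomial (Fin n × Fin n) ℂ) := by
    rw [perPoly, Matrix.permanent]
    rfl
  have hfact : (n.factorial : ℂ) ≠ 0 := Nat.cast_ne_zero.2 (Nat.factorial_ne_zero n)
  -- polarise each permutation monomial
  have hpol : ∀ σ : Equiv.Perm (Fin n), (∏ i, X (σ i, i) : MvPolynomial (Fin n × Fin n) ℂ) =
      ∑ S : Finset (Fin n), ((-1) ^ (n - S.card) / n.factorial : ℂ) •
        (∑ l ∈ S, (X (σ l, l) : MvPolynomial (Fin n × Fin n) ℂ)) ^ n := by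
    intro σ
    have h := sum_neg_one_pow_mul_sum_pow (K := MvPolynomial (Fin n × Fin n) ℂ)
      (fun l => X (σ l, l))
    have hinv : (C ((n.factorial : ℂ)⁻¹) : MvPolynomial (Fin n × Fin n) ℂ) * (n.factorial) = 1 := by
      rw [← map_natCast C, ← map_mul, inv_mul_cancel₀ hfact, map_one]
    calc (∏ i, X (σ i, i) : MvPolynomial (Fin n × Fin n) ℂ)
        = C ((n.factorial : ℂ)⁻¹) * ((n.factorial : MvPolynomial (Fin n × Fin n) ℂ) *
            ∏ i, X (σ i, i)) := by rw [← mul_assoc, hinv, one_mul]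
      _ = C ((n.factorial : ℂ)⁻¹) *
            ∑ S : Finset (Fin n), (-1) ^ (n - S.card) * (∑ l ∈ S, X (σ l, l)) ^ n := by rw [h]
      _ = ∑ S : Finset (Fin n), ((-1) ^ (n - S.card) / n.factorial : ℂ) •
            (∑ l ∈ S, (X (σ l, l) : MvPolynomial (Fin n × Fin n) ℂ)) ^ n := by
          rw [Finset.mul_sum]
          refine Finset.sum_congr rfl fun S _ => ?_
          rw [smul_eq_C_mul, div_eq_mul_inv, map_mul, map_pow, map_neg, map_one]
          ring
  rw [hper, Fintype.sum_prod_type]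
  exact Finset.sum_congr rfl fun σ _ => hpol σ

/-- The linear forms `L_{σ,S} = Σ_{l∈S} x_{σ l, l}` are affine (`totalDegree ≤ 1`). [folklore] -/
theorem totalDegree_sum_X_le (σ : Equiv.Perm (Fin n)) (S : Finset (Fin n)) :
    (∑ l ∈ S, (X (σ l, l) : MvPolynomial (Fin n × Fin n) ℂ)).totalDegree ≤ 1 := by
  refine (totalDegree_finsetSum _ _).trans (Finset.sup_le fun l _ => ?_)
  exact (totalDegree_X _).le

end Waring

/-! ## §4 Kumar's construction: two products of affine forms -/

section Kumar

variable {n : ℕ}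

/-- A change of scalars does not increase the total degree. [folklore] -/
theorem totalDegree_map_le {σ R S : Type*} [CommSemiring R] [CommSemiring S] (f : R →+* S)
    (p : MvPolynomial σ R) : (MvPolynomial.map f p).totalDegree ≤ p.totalDegree := by
  rw [totalDegree, totalDegree]
  exact Finset.sup_mono (support_map_subset f p)

/-- The affine factor `1 - a ε · L` (`a ∈ ℂ`) is affine when `L` is. [folklore] -/
theorem totalDegree_one_sub_le (a : ℂ) (L : MvPolynomial (Fin n × Fin n) ℂ)
    (hL : L.totalDegree ≤ 1) :
    (1 - C (Polynomial.C a * Polynomial.X) * MvPolynomial.map Polynomial.C L :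
      MvPolynomial (Fin n × Fin n) ℂ[X]).totalDegree ≤ 1 := by
  refine (totalDegree_sub _ _).trans (max_le (by rw [totalDegree_one]; exact zero_le_one) ?_)
  refine (totalDegree_mul _ _).trans ?_
  rw [totalDegree_C, zero_add]
  exact (totalDegree_map_le _ _).trans hL

/-- **The roots-of-unity product** (Kumar's factors `1 - ζ^k λ ε L`):
`Π_{k<n} (1 - ζ^k λ ε L) = 1 + ε^n · c · L^n` when `λ^n = -c`. [cite: Kumar2020BorderDepth3, Thm 1.1] -/
theorem prod_kumarFactor (hn : 0 < n) {ζ : ℂ} (hζ : IsPrimitiveRoot ζ n) (lam c : ℂ)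
    (hlam : lam ^ n = -c) (L : MvPolynomial (Fin n × Fin n) ℂ) :
    ∏ k ∈ Finset.range n, (1 - C (Polynomial.C (ζ ^ k * lam) * Polynomial.X) *
        MvPolynomial.map Polynomial.C L : MvPolynomial (Fin n × Fin n) ℂ[X]) =
      1 + C (Polynomial.X ^ n) * (C (Polynomial.C c) * MvPolynomial.map Polynomial.C (L ^ n)) := by
  have h := prod_one_sub_smul (B := MvPolynomial (Fin n × Fin n) ℂ[X]) hn hζ
    (C (Polynomial.C lam * Polynomial.X) * MvPolynomial.map Polynomial.C L)
  have hfac : ∀ k ∈ Finset.range n, (1 - C (Polynomial.C (ζ ^ k * lam) * Polynomial.X) *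
      MvPolynomial.map Polynomial.C L : MvPolynomial (Fin n × Fin n) ℂ[X]) =
      1 - algebraMap ℂ (MvPolynomial (Fin n × Fin n) ℂ[X]) ζ ^ k *
        (C (Polynomial.C lam * Polynomial.X) * MvPolynomial.map Polynomial.C L) := by
    intro k _
    rw [IsScalarTower.algebraMap_apply ℂ ℂ[X] (MvPolynomial (Fin n × Fin n) ℂ[X]),
      Polynomial.algebraMap_eq, MvPolynomial.algebraMap_eq, ← map_pow, ← map_pow, ← mul_assoc,
      ← map_mul, ← mul_assoc, ← map_mul]
  have h1 : (C (Polynomial.C lam * Polynomial.X) : MvPolynomial (Fin n × Fin n) ℂ[X]) ^ n =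
      -C (Polynomial.C c * Polynomial.X ^ n) := by
    rw [← map_pow, mul_pow, ← map_pow, hlam, map_neg, neg_mul, map_neg]
  rw [Finset.prod_congr rfl hfac, h, mul_pow, h1, map_pow (MvPolynomial.map Polynomial.C), map_mul]
  ring

/-- **The big product.**  With `λ_s^n = -c_s` for every `s = (σ, S)`, the product of all Kumar
factors over `(s, k)`, `k < n`, is `1 + ε^n per_n + ε^(2n) H`. [cite: Kumar2020BorderDepth3, Thm 1.1] -/
theorem exists_prod_kumar (hn : 0 < n) {ζ : ℂ} (hζ : IsPrimitiveRoot ζ n)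
    (lam : Equiv.Perm (Fin n) × Finset (Fin n) → ℂ)
    (hlam : ∀ s, lam s ^ n = -((-1) ^ (n - s.2.card) / n.factorial : ℂ)) :
    ∃ H : MvPolynomial (Fin n × Fin n) ℂ[X],
      ∏ p : (Equiv.Perm (Fin n) × Finset (Fin n)) × Fin n,
        (1 - C (Polynomial.C (ζ ^ (p.2 : ℕ) * lam p.1) * Polynomial.X) *
          MvPolynomial.map Polynomial.C (∑ l ∈ p.1.2, X (p.1.1 l, l)) :
            MvPolynomial (Fin n × Fin n) ℂ[X]) =
      1 + C (Polynomial.X ^ n) * MvPolynomial.map Polynomial.C (perPoly (Fin n) ℂ) +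
        C (Polynomial.X ^ n) ^ 2 * H := by
  obtain ⟨H, hH⟩ := exists_prod_one_add_mul
    (Finset.univ : Finset (Equiv.Perm (Fin n) × Finset (Fin n)))
    (C (Polynomial.X ^ n) : MvPolynomial (Fin n × Fin n) ℂ[X])
    (fun s => C (Polynomial.C ((-1) ^ (n - s.2.card) / n.factorial : ℂ)) *
      MvPolynomial.map Polynomial.C ((∑ l ∈ s.2, X (s.1 l, l)) ^ n))
  refine ⟨H, ?_⟩
  have hsum : ∑ s : Equiv.Perm (Fin n) × Finset (Fin n),
      C (Polynomial.C ((-1) ^ (n - s.2.card) / n.factorial : ℂ)) *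
        MvPolynomial.map Polynomial.C ((∑ l ∈ s.2, X (s.1 l, l)) ^ n) =
      MvPolynomial.map Polynomial.C (perPoly (Fin n) ℂ) := by
    rw [perPoly_eq_sum_smul_pow, map_sum]
    refine Finset.sum_congr rfl fun s _ => ?_
    rw [smul_eq_C_mul, map_mul, map_C]
  rw [Fintype.prod_prod_type]
  have hs : ∀ s : Equiv.Perm (Fin n) × Finset (Fin n),
      ∏ k : Fin n, (1 - C (Polynomial.C (ζ ^ (k : ℕ) * lam s) * Polynomial.X) *
          MvPolynomial.map Polynomial.C (∑ l ∈ s.2, X (s.1 l, l)) :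
            MvPolynomial (Fin n × Fin n) ℂ[X]) =
        1 + C (Polynomial.X ^ n) * (C (Polynomial.C ((-1) ^ (n - s.2.card) / n.factorial : ℂ)) *
          MvPolynomial.map Polynomial.C ((∑ l ∈ s.2, X (s.1 l, l)) ^ n)) := by
    intro s
    rw [← prod_kumarFactor hn hζ (lam s) _ (hlam s) (∑ l ∈ s.2, X (s.1 l, l))]
    exact Fin.prod_univ_eq_prod_range (fun k => (1 - C (Polynomial.C (ζ ^ k * lam s) *
      Polynomial.X) * MvPolynomial.map Polynomial.C (∑ l ∈ s.2, X (s.1 l, l)) :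
        MvPolynomial (Fin n × Fin n) ℂ[X])) n
  rw [Finset.prod_congr rfl fun s _ => hs s, hH, hsum]

/-- **Border fan-in two for the permanent (Kumar).**  For `n ≥ 1` there are `D`, `q` and TWO
products of `D` affine forms over `ℂ[ε]` with `Π_j ℓ_0j + Π_j ℓ_1j = ε^q per_n + ε^(q+1) G`:
the padded permanent lies in `σ_2(Ch_D(ℂ^(n²+1)))` (border) with `D = n · n! · 2^n`.
[cite: Kumar2020BorderDepth3, Thm 1.1] -/
theorem exists_border_fanInTwo (n : ℕ) (hn : 1 ≤ n) :
    ∃ (D q : ℕ) (ℓ : Fin 2 → Fin D → MvPolynomial (Fin n × Fin n) ℂ[X])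
      (G : MvPolynomial (Fin n × Fin n) ℂ[X]),
      (∀ i j, (ℓ i j).totalDegree ≤ 1) ∧
      ∑ i, ∏ j, ℓ i j = C (Polynomial.X ^ q) * MvPolynomial.map Polynomial.C (perPoly (Fin n) ℂ) +
        C (Polynomial.X ^ (q + 1)) * G := by
  classical
  have hn0 : 0 < n := hn
  -- a primitive `n`-th root of unity and `n`-th roots of the (negated) Waring coefficients
  obtain ⟨ζ, hζ⟩ : ∃ ζ : ℂ, IsPrimitiveRoot ζ n :=
    ⟨Complex.exp (2 * Real.pi * Complex.I / n), Complex.isPrimitiveRoot_exp n hn0.ne'⟩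
  have hroot : ∀ s : Equiv.Perm (Fin n) × Finset (Fin n), ∃ lam : ℂ,
      lam ^ n = -((-1) ^ (n - s.2.card) / n.factorial : ℂ) :=
    fun s => IsAlgClosed.exists_pow_nat_eq _ hn0
  choose lam hlam using hroot
  obtain ⟨H, hH⟩ := exists_prod_kumar hn0 hζ lam hlam
  -- index the `D = |ι| · n` factors of the big product by `Fin D`
  obtain ⟨D, hD⟩ : ∃ D : ℕ, D = Fintype.card ((Equiv.Perm (Fin n) × Finset (Fin n)) × Fin n) :=
    ⟨_, rfl⟩
  have hDpos : 0 < D := by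
    rw [hD, Fintype.card_prod, Fintype.card_fin]
    exact Nat.mul_pos Fintype.card_pos hn0
  obtain ⟨e⟩ : Nonempty (Fin D ≃ (Equiv.Perm (Fin n) × Finset (Fin n)) × Fin n) :=
    ⟨(finCongr hD).trans (Fintype.equivFin _).symm⟩
  -- the two rows: `-1, 1, …, 1` and the Kumar factors
  refine ⟨D, n, fun i j => if i = 0 then (if (j : ℕ) = 0 then -1 else 1) else
      (1 - C (Polynomial.C (ζ ^ ((e j).2 : ℕ) * lam (e j).1) * Polynomial.X) *
        MvPolynomial.map Polynomial.C (∑ l ∈ (e j).1.2, X ((e j).1.1 l, l))),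
    C (Polynomial.X ^ (n - 1)) * H, ?_, ?_⟩
  · intro i j
    beta_reduce
    by_cases hi : i = 0
    · rw [if_pos hi]
      by_cases hj : (j : ℕ) = 0
      · rw [if_pos hj, totalDegree_neg, totalDegree_one]; exact zero_le_one
      · rw [if_neg hj, totalDegree_one]; exact zero_le_one
    · rw [if_neg hi]
      exact totalDegree_one_sub_le _ _ (totalDegree_sum_X_le n _ _)
  · have hrow0 : ∏ j : Fin D, (if ((0 : Fin 2) = 0) then (if (j : ℕ) = 0 then -1 else 1) else
        (1 - C (Polynomial.C (ζ ^ ((e j).2 : ℕ) * lam (e j).1) * Polynomial.X) *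
          MvPolynomial.map Polynomial.C (∑ l ∈ (e j).1.2, X ((e j).1.1 l, l))) :
            MvPolynomial (Fin n × Fin n) ℂ[X]) = -1 := by
      simp only [if_true]
      rw [Fintype.prod_eq_single (⟨0, hDpos⟩ : Fin D)]
      · exact if_pos rfl
      · intro j hj
        rw [if_neg]
        exact fun h => hj (Fin.ext h)
    have hrow1 : ∏ j : Fin D, (if ((1 : Fin 2) = 0) then (if (j : ℕ) = 0 then -1 else 1) else
        (1 - C (Polynomial.C (ζ ^ ((e j).2 : ℕ) * lam (e j).1) * Polynomial.X) *
          MvPolynomial.map Polynomial.C (∑ l ∈ (e j).1.2, X ((e j).1.1 l, l))) :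
            MvPolynomial (Fin n × Fin n) ℂ[X]) =
        1 + C (Polynomial.X ^ n) * MvPolynomial.map Polynomial.C (perPoly (Fin n) ℂ) +
          C (Polynomial.X ^ n) ^ 2 * H := by
      rw [← hH]
      simp only [show ¬ ((1 : Fin 2) = 0) from by decide, if_false]
      exact Fintype.prod_equiv e _ _ fun _ => rfl
    rw [Fin.sum_univ_two, hrow0, hrow1]
    have hpow : (C (Polynomial.X ^ n) : MvPolynomial (Fin n × Fin n) ℂ[X]) ^ 2 =
        C (Polynomial.X ^ (n + 1)) * C (Polynomial.X ^ (n - 1)) := by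
      rw [sq, ← map_mul, ← map_mul, ← pow_add, ← pow_add]
      congr 2
      omega
    rw [hpow]
    ring

/-- **`ChowBorderBound` is false without its bound on `D`** (registered sub-goal
`chowBorderBound_false_without_DBound` of stmt-ValiantsHypothesis-5936): deleting the hypothesis
`D ≤ (n+2)^(c⌊√n⌋+c)` from the crux makes it false — at `c = 1`, `r = 2 ≤ (n+2)^(⌊√n⌋+1)` and
Kumar's `D`, a border expression exists for every `n ≥ 1`.  Any proof of the crux must therefore
use the degree bound. [cite: Kumar2020BorderDepth3, Thm 1.1] -/
theorem chowBorderBound_false_without_DBound :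
    ¬ ∀ c : ℕ, ∃ n₀ : ℕ, ∀ n ≥ n₀, ∀ r D : ℕ, r ≤ (n + 2) ^ (c * Nat.sqrt n + c) →
      ¬ ∃ (q : ℕ) (ℓ : Fin r → Fin D → MvPolynomial (Fin n × Fin n) (Polynomial ℂ))
          (G : MvPolynomial (Fin n × Fin n) (Polynomial ℂ)),
          (∀ i j, (ℓ i j).totalDegree ≤ 1) ∧
          (∑ i, ∏ j, ℓ i j) =
            MvPolynomial.C (Polynomial.X ^ q) *
                MvPolynomial.map Polynomial.C
                  (Literature.Computability.AlgebraicComplexity.perPoly (Fin n) ℂ) +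
              MvPolynomial.C (Polynomial.X ^ (q + 1)) * G := by
  intro h
  obtain ⟨n₀, h₀⟩ := h 1
  obtain ⟨D, q, ℓ, G, hℓ, hsum⟩ := exists_border_fanInTwo (max n₀ 1) (le_max_right _ _)
  refine h₀ (max n₀ 1) (le_max_left _ _) 2 D ?_ ⟨q, ℓ, G, hℓ, hsum⟩
  calc 2 ≤ max n₀ 1 + 2 := by omega
    _ ≤ (max n₀ 1 + 2) ^ (1 * Nat.sqrt (max n₀ 1) + 1) := Nat.le_self_pow (by omega) _

end Kumar

end Summit.ValiantsHypothesis.ValiantsHypothesis.Theorems.ChowBorderBound.NegativeDBound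

end
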